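import Summits.Ventures.LatticeQCDFlow.Scaling.GraphSchemeSharpLaw
import Literature.Probability.MarkovChains.SpectralGapVariational
import Literature.Probability.MarkovChains.RelaxationTimeLowerBound

/-!
HONEST FRAMING: exact (Metropolis-corrected) sampling algorithms for lattice gauge theory; figures
of merit are autocorrelation/cost numbers at stated couplings and volumes; no continuum-physics
claim.

# GraphSchemeSpectralGap — THE SPECTRAL GAP OF THE HOMOGENEOUS EXCHANGE SCHEME ON A SWAP LIST IS EXACTLY THE ROBIN GROUND-STATE RATE: **`γ(P) = ρ`**
# (`γ ≤ ρ`: the one-level sum is an exact eigenfunction at `1 − ρ`; `γ ≥ ρ`: the freshness ceiling `d(n) ≤ (1−ρ)ⁿΣc/c_min` forces `|λ₂|ⁿ ≤ 2d(n)`, hence `λ₂ ≤ 1 − ρ`); ON EVERY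
# CONNECTED LIST `min{t/(2(K+1)K²m), h/(2(K+1))} ≤ γ(P) = ρ_G ≤ h/(K+1)` (lean-2 GEN-48, ours)

Venture-side (OURS).  Cell `lqcd-flow` (pub-lqcd), unit `pub-lqcd-lean-2-g48`, 2026-08-31.  Chapter AI (the sizes of the Robin ground state), file 10 — parents AI4 `GraphSchemeSharpLaw` and the
Literature's `SpectralGapVariational` (Levin–Peres–Wilmer Lemma 13.7 ∕ Remark 13.8: `γ·Var_π f ≤ 𝓔(f)`, `𝓔(f) = (1−λ)‖f‖²_π` for eigenfunctions, an eigenfunction at `λ₂`) and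
`RelaxationTimeLowerBound` (`Pᵗf = λᵗf`).  For the scheme `P = t·ptGraphSwap ν^{⊗} e 1 + (1−t)·prodKernel w M` (one positive law, exact hot sampler, idle cold kernels, `h = (1−t)w_0`,
distinct endpoints, `|S| ≥ 2`) and a solution `(c, ρ)` of AH1's vertex equations: (§2) `Φ = Σ_kc_k(𝟙{x_k=u} − ν(u))` satisfies `PΦ = (1−ρ)Φ` (AH1), has `π`-mean `0` and positive variance, so
Remark 13.8 gives **`γ ≤ ρ`** whenever `Σc ≠ 0`; (§1, §3) for a real eigenfunction `g ⊥_π 1` at `λ₂ = 1 − γ` (Lemma 13.7) `|λ₂|ⁿ|g(x⋆)| = |Σ_y(Pⁿ(x⋆,y) − π(y))g(y)| ≤ 2d(n)‖g‖_∞`, and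
AH7's ceiling `d(n) ≤ (1−ρ)ⁿΣc/c_min` for a positive solution gives `|λ₂|ⁿ ≤ 2(Σc/c_min)(1−ρ)ⁿ` for every `n`, hence `λ₂ ≤ 1 − ρ` (Bernoulli): **`γ ≥ ρ`**.  (§4) **`γ(P) = ρ`** for every
positive solution; on every connected list `γ(P)` IS the ground-state rate of AH8, inside AI7's universal window.  No definitions.

* §1 `eigen_pow_le_two_mul_worstTvDist_of_meanZero`, `le_of_abs_pow_le_mul_pow`; §2 `graphScheme_spectralGap_le`; §3 `graphScheme_spectralGap_ge`; §4 `graphScheme_spectralGap_eq`,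
  `graphScheme_spectralGap_exists`; §5 `graphScheme_mixingTime_ge_relax` (Thm 12.5 at the exact eigenvalue: `(1/ρ − 1)·log(1/(2ε)) ≤ t_mix(ε)` for every `ε`).

Reading (no numerics implied): the relaxation time of the homogeneous replica-exchange scheme on any connected swap topology is `1/ρ_G` exactly — path `≍ max{K³/t, K/h}`, star `≍ max{K/t, K/h}`,
complete list `≍ max{K²/t, K/h}`, ring `≍ max{K³/t, K/h}` — and the mixing time carries the extra logarithm on both sides (AI4).  Literature grade (cell rule): OWN (standard spectral facts from
the Literature typed for this chain); nothing new cited; no new bib keys.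
-/

noncomputable section

open Finset Function Matrix
open Literature.Probability.MarkovChains

namespace Summit.Ventures.LatticeQCDFlow.Scaling

/-! ## §1 Two generic facts -/

/-- **A real eigenfunction orthogonal to `π` decays no faster than the chain mixes: `|λ|ᵗ ≤ 2d(t)`** (`Σ_yP(x,y)f(y) = λf(x)` for all `x`, `f ≠ 0`, `Σ_xπ(x)f(x) = 0`; no `λ ≠ 1` needed). [ours] -/
theorem eigen_pow_le_two_mul_worstTvDist_of_meanZero {X : Type*} [Fintype X] [DecidableEq X] {P : X → X → ℝ} {π : X → ℝ} {f : X → ℝ} {lam : ℝ}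
    (hf : ∀ x, ∑ y, P x y * f y = lam * f x) (hf0 : f ≠ 0) (hmean : ∑ x, π x * f x = 0) (t : ℕ) :
    |lam| ^ t ≤ 2 * worstTvDist P π t := by
  obtain ⟨x₁, hx₁⟩ : ∃ x, f x ≠ 0 := Function.ne_iff.mp hf0
  obtain ⟨x, -, hx⟩ := exists_max_image univ (fun x => |f x|) ⟨x₁, mem_univ _⟩
  have hfx : 0 < |f x| := (abs_pos.mpr hx₁).trans_le (hx x₁ (mem_univ _))
  set L : X → ℝ := lawAt P (Pi.single x 1) t with hL
  have hf' : ∀ z, ∑ y, (P z y : ℂ) * (f y : ℂ) = (lam : ℂ) * (f z : ℂ) := by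
    intro z
    have := congrArg (fun r : ℝ => (r : ℂ)) (hf z)
    push_cast at this
    exact this
  have hkeyC := sum_kernel_mul_eigenfunction hf' t x
  have hkey : ∑ y, L y * f y = lam ^ t * f x := by
    have h2 : ((∑ y, L y * f y : ℝ) : ℂ) = ((lam ^ t * f x : ℝ) : ℂ) := by push_cast; rw [hL]; exact hkeyC
    exact_mod_cast h2
  have hkey2 : lam ^ t * f x = ∑ y, (L y - π y) * f y := by
    rw [← hkey]; simp only [sub_mul, sum_sub_distrib, hmean, sub_zero]
  have h1 : |lam| ^ t * |f x| ≤ 2 * worstTvDist P π t * |f x| := by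
    calc |lam| ^ t * |f x| = |∑ y, (L y - π y) * f y| := by rw [← abs_pow, ← abs_mul, hkey2]
      _ ≤ ∑ y, |(L y - π y) * f y| := abs_sum_le_sum_abs _ _
      _ = ∑ y, |L y - π y| * |f y| := sum_congr rfl fun y _ => abs_mul _ _
      _ ≤ ∑ y, |L y - π y| * |f x| := sum_le_sum fun y _ => mul_le_mul_of_nonneg_left (hx y (mem_univ _)) (abs_nonneg _)
      _ = 2 * tvDist L π * |f x| := by rw [← sum_mul]; unfold tvDist; ring
      _ ≤ 2 * worstTvDist P π t * |f x| :=
          mul_le_mul_of_nonneg_right (mul_le_mul_of_nonneg_left (tvDist_single_le_worstTvDist P π t x) (by norm_num)) (abs_nonneg _)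
  exact le_of_mul_le_mul_right h1 hfx

/-- **Geometric comparison:** `0 < b`, `|a|ⁿ ≤ C·bⁿ` for every `n` ⇒ `a ≤ b` (Bernoulli on `|a|/b`). [ours] -/
theorem le_of_abs_pow_le_mul_pow {a b C : ℝ} (hb : 0 < b) (h : ∀ n : ℕ, |a| ^ n ≤ C * b ^ n) : a ≤ b := by
  refine le_trans (le_abs_self a) ?_
  by_contra hlt
  push Not at hlt
  set q : ℝ := |a| / b with hq
  have hq1 : 1 < q := by rw [hq, lt_div_iff₀ hb, one_mul]; exact hlt
  have hqn : ∀ n : ℕ, q ^ n ≤ C := by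
    intro n
    have hbn : 0 < b ^ n := pow_pos hb n
    have := h n
    rw [hq, div_pow, div_le_iff₀ hbn]
    exact this
  -- Bernoulli: `1 + n(q−1) ≤ qⁿ ≤ C` for all `n`
  obtain ⟨n, hn⟩ := exists_nat_gt ((C - 1) / (q - 1))
  have hB := one_add_mul_le_pow (show (-2 : ℝ) ≤ q - 1 by linarith) n
  rw [add_sub_cancel] at hB
  have h3 : 1 + (n : ℝ) * (q - 1) ≤ C := le_trans hB (hqn n)
  have hq0 : 0 < q - 1 := by linarith
  rw [div_lt_iff₀ hq0] at hn
  linarith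

/-! ## §2 `γ ≤ ρ`: the exact eigenfunction -/

variable {S : Type*} [Fintype S] [DecidableEq S] {K m : ℕ} (e : Fin m → Fin (K + 1) × Fin (K + 1)) {ν : S → ℝ} {M : Fin (K + 1) → S → S → ℝ} {w : Fin (K + 1) → ℝ} {t : ℝ}
  {P : (Fin (K + 1) → S) → (Fin (K + 1) → S) → ℝ}

/-- **`γ(P) ≤ ρ` FROM ANY SOLUTION OF THE VERTEX EQUATIONS WITH `Σc ≠ 0`** (`|S| ≥ 2`, `m ≥ 1`, distinct endpoints, `0 < t < 1`, `w` a probability vector, one positive law, exact hot sampler, idle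
cold kernels, `ρ > 0`). [ours] -/
theorem graphScheme_spectralGap_le [Nontrivial S] (hm : 1 ≤ m) (he : ∀ r, (e r).1 ≠ (e r).2) (hν : ∀ v, 0 < ν v) (hν1 : ∑ v, ν v = 1) (hM0 : ∀ u v, M 0 u v = ν v)
    (hidle : ∀ i : Fin K, ∀ u v, M i.succ u v = if v = u then 1 else 0) (hw0 : ∀ k, 0 ≤ w k) (hw1 : ∑ k, w k = 1) (ht0 : 0 < t) (ht1 : t < 1)
    (hP : ∀ x y, P x y = t * ptGraphSwap (fun _ : Fin (K + 1) => ν) e (fun _ => Equiv.refl S) x y + (1 - t) * prodKernel w M x y)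
    {c : Fin (K + 1) → ℝ} {ρ : ℝ}
    (hvertex : ∀ k : Fin (K + 1), t / m * ∑ r : Fin m, ((if k = (e r).1 then c (e r).2 - c (e r).1 else 0) + (if k = (e r).2 then c (e r).1 - c (e r).2 else 0))
      - (if k = 0 then (1 - t) * w 0 * c 0 else 0) = -ρ * c k)
    (hρ0 : 0 < ρ) (hsum : ∑ k : Fin (K + 1), c k ≠ 0) :
    spectralGap (tensorFun (fun _ : Fin (K + 1) => ν)) P ≤ ρ := by
  have hμ : ∀ (k : Fin (K + 1)) (v : S), 0 < (fun _ : Fin (K + 1) => ν) k v := fun _ v => hν v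
  have hπpos : ∀ x, 0 < tensorFun (fun _ : Fin (K + 1) => ν) x := tensorFun_pos hμ
  have hπ1 : ∑ x, tensorFun (fun _ : Fin (K + 1) => ν) x = 1 := sum_tensorFun_eq_one _ fun _ => hν1
  have hPst := graphScheme_isRowStochastic e hν hν1 hM0 hidle hw0 hw1 ht0.le ht1.le hP
  have hDB := graphScheme_detailedBalance e hν hν1 hM0 hidle hP
  have hst := hDB.isStationary hPst.2
  -- a content with `ν(u) < 1`
  obtain ⟨u⟩ : Nonempty S := inferInstance
  obtain ⟨v, hvu⟩ := exists_ne u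
  have hνu : ν u < 1 := by
    have : ν u + ν v ≤ ∑ s, ν s := by
      rw [← sum_pair (Ne.symm hvu)]; exact sum_le_univ_sum_of_nonneg fun s => (hν s).le
    linarith [hν v]
  -- the exact eigenfunction
  set a : S → ℝ := fun s => (if s = u then (1 : ℝ) else 0) - ν u with ha_def
  set Φ : (Fin (K + 1) → S) → ℝ := fun x => ∑ k : Fin (K + 1), c k * a (x k) with hΦ_def
  have hΦ : ∀ x, Φ x = ∑ k : Fin (K + 1), c k * a (x k) := fun x => rfl
  have ha0 : ∑ s, ν s * a s = 0 := centredIndicator_mean hν1 u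
  have heig : ∀ x, ∑ y, P x y * Φ y = (1 - ρ) * Φ x := graphScheme_oneLevel_eigen e hm he hν hν1 hM0 hidle hw1 hP ha0 hΦ hvertex
  have hmv : P *ᵥ Φ = (1 - ρ) • Φ := by
    funext x
    simp only [Matrix.mulVec, dotProduct, Pi.smul_apply, smul_eq_mul]
    exact heig x
  -- mean zero and the variance
  have hmean0 : lawMean (tensorFun (fun _ : Fin (K + 1) => ν)) Φ = 0 := by
    have heig' : ∀ x, |∑ y, P x y * Φ y - (1 - ρ) * Φ x| ≤ 0 := fun x => by rw [heig x, sub_self, abs_zero]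
    have h := approxEigen_lawMean_stationary heig' (by linarith) (fun x => (hπpos x).le) hπ1 hst
    rw [zero_div] at h
    exact abs_eq_zero.mp (le_antisymm h (abs_nonneg _))
  have hvar : lawVariance (tensorFun (fun _ : Fin (K + 1) => ν)) Φ = piInner (tensorFun (fun _ : Fin (K + 1) => ν)) Φ Φ := by
    unfold lawVariance piInner
    rw [hmean0]
    exact sum_congr rfl fun x _ => by ring
  have hE := dirichletForm_eq_of_eigen hPst hst hmv
  rw [show 1 - (1 - ρ) = ρ by ring] at hE
  have h138 := LevinPeres2017_remark_13_8 hπpos hπ1 hPst hDB Φ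
  rw [hE, hvar] at h138
  -- `⟨Φ,Φ⟩_π > 0`: at the monochromatic state `Φ = (1−ν(u))Σc ≠ 0`
  have hΦ0 : Φ (fun _ : Fin (K + 1) => u) = (1 - ν u) * ∑ k : Fin (K + 1), c k := by
    rw [hΦ, mul_sum]
    exact sum_congr rfl fun k _ => by rw [ha_def]; simp only [if_true]; ring
  have hΦne : Φ (fun _ : Fin (K + 1) => u) ≠ 0 := by
    rw [hΦ0]; exact mul_ne_zero (by linarith) hsum
  have hI : 0 < piInner (tensorFun (fun _ : Fin (K + 1) => ν)) Φ Φ := by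
    unfold piInner
    have hterm : 0 < tensorFun (fun _ : Fin (K + 1) => ν) (fun _ => u) * (Φ (fun _ => u) * Φ (fun _ => u)) :=
      mul_pos (hπpos _) (mul_self_pos.mpr hΦne)
    exact lt_of_lt_of_le hterm (Finset.single_le_sum (fun x _ => mul_nonneg (hπpos x).le (mul_self_nonneg _)) (mem_univ _))
  exact le_of_mul_le_mul_right h138 hI

/-! ## §3 `γ ≥ ρ`: the freshness ceiling against the second eigenfunction -/

/-- **`ρ ≤ γ(P)` FROM A POSITIVE SOLUTION** (`c_k ≥ c_min > 0`, `0 < ρ < 1`, `w_0 > 0`; same scheme, `|S| ≥ 2`). [ours] -/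
theorem graphScheme_spectralGap_ge [Nontrivial S] (hm : 1 ≤ m) (he : ∀ r, (e r).1 ≠ (e r).2) (hν : ∀ v, 0 < ν v) (hν1 : ∑ v, ν v = 1) (hM0 : ∀ u v, M 0 u v = ν v)
    (hidle : ∀ i : Fin K, ∀ u v, M i.succ u v = if v = u then 1 else 0) (hw0 : ∀ k, 0 ≤ w k) (hw00 : 0 < w 0) (hw1 : ∑ k, w k = 1) (ht0 : 0 < t) (ht1 : t < 1)
    (hP : ∀ x y, P x y = t * ptGraphSwap (fun _ : Fin (K + 1) => ν) e (fun _ => Equiv.refl S) x y + (1 - t) * prodKernel w M x y)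
    {c : Fin (K + 1) → ℝ} {ρ cmin : ℝ} (hρ0 : 0 < ρ) (hρ1 : ρ < 1) (hcmin : 0 < cmin) (hcge : ∀ k, cmin ≤ c k)
    (hvertex : ∀ k : Fin (K + 1), t / m * ∑ r : Fin m, ((if k = (e r).1 then c (e r).2 - c (e r).1 else 0) + (if k = (e r).2 then c (e r).1 - c (e r).2 else 0))
      - (if k = 0 then (1 - t) * w 0 * c 0 else 0) = -ρ * c k) :
    ρ ≤ spectralGap (tensorFun (fun _ : Fin (K + 1) => ν)) P := by
  have hμ : ∀ (k : Fin (K + 1)) (v : S), 0 < (fun _ : Fin (K + 1) => ν) k v := fun _ v => hν v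
  have hπpos : ∀ x, 0 < tensorFun (fun _ : Fin (K + 1) => ν) x := tensorFun_pos hμ
  have hπ1 : ∑ x, tensorFun (fun _ : Fin (K + 1) => ν) x = 1 := sum_tensorFun_eq_one _ fun _ => hν1
  have hPst := graphScheme_isRowStochastic e hν hν1 hM0 hidle hw0 hw1 ht0.le ht1.le hP
  have hDB := graphScheme_detailedBalance e hν hν1 hM0 hidle hP
  have hM := (homLadder_kernels hν hν1 hM0 hidle).1
  have hh0 : 0 < (1 - t) * w 0 := mul_pos (by linarith) hw00
  have hw01 : w 0 ≤ 1 := by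
    calc w 0 ≤ ∑ k, w k := Finset.single_le_sum (fun k _ => hw0 k) (mem_univ 0)
      _ = 1 := hw1
  -- the freshness ceiling (AH7) in lazy form
  have hPl : ∀ x y, P x y = t * ptGraphProposal e (fun _ => Equiv.refl S) x y + (1 - t) * w 0 * coordKernel M 0 x y + (1 - t - (1 - t) * w 0) * (if y = x then 1 else 0) :=
    fun x y => by rw [hP, graphScheme_lazyForm e hm he hν hidle hw1]
  have hceil : ∀ n : ℕ, worstTvDist P (tensorFun (fun _ : Fin (K + 1) => ν)) n ≤ (1 - ρ) ^ n * (∑ k : Fin (K + 1), c k) / cmin := fun n =>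
    graphScheme_worstTvDist_le_mode e (h := (1 - t) * w 0) hm he ht0 hh0 (by nlinarith) hν hν1 hM hM0 hPl hρ0 hρ1.le hcmin hcge hvertex n
  -- the second eigenfunction
  obtain ⟨g, hg0, hg1, _, hPg⟩ := exists_eigenfunction_spectralGap hπpos hπ1 hPst hDB
  have hgne : g ≠ 0 := by
    intro hz
    rw [hz] at hg1
    unfold piInner at hg1
    simp at hg1
  have hf : ∀ x, ∑ y, P x y * g y = secondEigenvalue (tensorFun (fun _ : Fin (K + 1) => ν)) P * g x := by
    intro x
    have := congrFun hPg x
    simp only [Matrix.mulVec, dotProduct, Pi.smul_apply, smul_eq_mul] at this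
    exact this
  have hpow : ∀ n : ℕ, |secondEigenvalue (tensorFun (fun _ : Fin (K + 1) => ν)) P| ^ n ≤ (2 * (∑ k : Fin (K + 1), c k) / cmin) * (1 - ρ) ^ n := by
    intro n
    have h1 := eigen_pow_le_two_mul_worstTvDist_of_meanZero hf hgne hg0 n
    have h2 := hceil n
    calc |secondEigenvalue (tensorFun (fun _ : Fin (K + 1) => ν)) P| ^ n ≤ 2 * worstTvDist P (tensorFun (fun _ : Fin (K + 1) => ν)) n := h1
      _ ≤ 2 * ((1 - ρ) ^ n * (∑ k : Fin (K + 1), c k) / cmin) := by linarith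
      _ = (2 * (∑ k : Fin (K + 1), c k) / cmin) * (1 - ρ) ^ n := by ring
  have hlam2 : secondEigenvalue (tensorFun (fun _ : Fin (K + 1) => ν)) P ≤ 1 - ρ := le_of_abs_pow_le_mul_pow (by linarith) hpow
  unfold spectralGap
  linarith

/-! ## §4 Equality -/

/-- **THE SPECTRAL GAP IS THE GROUND-STATE RATE: `γ(P) = ρ`** for every positive solution `(c, ρ)`, `ρ > 0`, of the vertex equations (`|S| ≥ 2`, `m ≥ 1`, distinct endpoints, `0 < t < 1`,
`w` a probability vector with `w_0 > 0`, one positive law, exact hot sampler, idle cold kernels, `h = (1−t)w_0`). [ours] -/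
theorem graphScheme_spectralGap_eq [Nontrivial S] (hm : 1 ≤ m) (he : ∀ r, (e r).1 ≠ (e r).2) (hν : ∀ v, 0 < ν v) (hν1 : ∑ v, ν v = 1) (hM0 : ∀ u v, M 0 u v = ν v)
    (hidle : ∀ i : Fin K, ∀ u v, M i.succ u v = if v = u then 1 else 0) (hw0 : ∀ k, 0 ≤ w k) (hw00 : 0 < w 0) (hw1 : ∑ k, w k = 1) (ht0 : 0 < t) (ht1 : t < 1)
    (hP : ∀ x y, P x y = t * ptGraphSwap (fun _ : Fin (K + 1) => ν) e (fun _ => Equiv.refl S) x y + (1 - t) * prodKernel w M x y)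
    {c : Fin (K + 1) → ℝ} {ρ : ℝ} (hρ0 : 0 < ρ) (hc : ∀ k, 0 < c k)
    (hvertex : ∀ k : Fin (K + 1), t / m * ∑ r : Fin m, ((if k = (e r).1 then c (e r).2 - c (e r).1 else 0) + (if k = (e r).2 then c (e r).1 - c (e r).2 else 0))
      - (if k = 0 then (1 - t) * w 0 * c k else 0) = -ρ * c k) :
    spectralGap (tensorFun (fun _ : Fin (K + 1) => ν)) P = ρ := by
  -- sizes: `ρ ≤ h/(K+1) < 1`, `c_0 = min`
  have hrho := groundState_rho_le_hot e hc ht0.le hvertex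
  have hw01 : w 0 ≤ 1 := by
    calc w 0 ≤ ∑ k, w k := Finset.single_le_sum (fun k _ => hw0 k) (mem_univ 0)
      _ = 1 := hw1
  have hρ1 : ρ < 1 := by
    have hK1 : (1 : ℝ) ≤ (K : ℝ) + 1 := by have : (0 : ℝ) ≤ K := Nat.cast_nonneg K; linarith
    have h1 : ρ ≤ ρ * ((K : ℝ) + 1) := le_mul_of_one_le_right hρ0.le hK1
    nlinarith
  have hmin := groundState_hot_is_min e hm ht0 hρ0 hc hvertex
  have hsum : ∑ k : Fin (K + 1), c k ≠ 0 := by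
    have : c 0 ≤ ∑ k : Fin (K + 1), c k := Finset.single_le_sum (fun k _ => (hc k).le) (mem_univ 0)
    linarith [hc 0]
  have hvertex' : ∀ k : Fin (K + 1), t / m * ∑ r : Fin m, ((if k = (e r).1 then c (e r).2 - c (e r).1 else 0) + (if k = (e r).2 then c (e r).1 - c (e r).2 else 0))
      - (if k = 0 then (1 - t) * w 0 * c 0 else 0) = -ρ * c k := by
    intro k
    have := hvertex k
    by_cases hk : k = 0
    · subst hk; exact this
    · rw [if_neg hk] at this ⊢; exact this
  exact le_antisymm (graphScheme_spectralGap_le e hm he hν hν1 hM0 hidle hw0 hw1 ht0 ht1 hP hvertex' hρ0 hsum)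
    (graphScheme_spectralGap_ge e hm he hν hν1 hM0 hidle hw0 hw00 hw1 ht0 ht1 hP hρ0 hρ1 (hc 0) hmin hvertex')

/-- **ON EVERY CONNECTED SWAP LIST THE SPECTRAL GAP IS THE ROBIN RATE `ρ_G` OF AH8, INSIDE THE UNIVERSAL WINDOW:** there are `ρ` and `c > 0` (`Σc² = 1`, the vertex equations) with
**`γ(P) = ρ`** and `ρ·(K+1) ≤ h`. [ours] -/
theorem graphScheme_spectralGap_exists [Nontrivial S] (hm : 1 ≤ m) (he : ∀ r, (e r).1 ≠ (e r).2)
    (hconn : ∀ A : Finset (Fin (K + 1)), A.Nonempty → A ≠ univ → ∃ r : Fin m, ((e r).1 ∈ A ∧ (e r).2 ∉ A) ∨ ((e r).2 ∈ A ∧ (e r).1 ∉ A))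
    (hν : ∀ v, 0 < ν v) (hν1 : ∑ v, ν v = 1) (hM0 : ∀ u v, M 0 u v = ν v) (hidle : ∀ i : Fin K, ∀ u v, M i.succ u v = if v = u then 1 else 0)
    (hw0 : ∀ k, 0 ≤ w k) (hw00 : 0 < w 0) (hw1 : ∑ k, w k = 1) (ht0 : 0 < t) (ht1 : t < 1)
    (hP : ∀ x y, P x y = t * ptGraphSwap (fun _ : Fin (K + 1) => ν) e (fun _ => Equiv.refl S) x y + (1 - t) * prodKernel w M x y) :
    ∃ (ρ : ℝ) (c : Fin (K + 1) → ℝ), 0 < ρ ∧ ρ * ((K : ℝ) + 1) ≤ (1 - t) * w 0 ∧ (∀ k, 0 < c k) ∧ ∑ k : Fin (K + 1), c k ^ 2 = 1 ∧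
      (∀ k : Fin (K + 1), t / m * ∑ r : Fin m, ((if k = (e r).1 then c (e r).2 - c (e r).1 else 0) + (if k = (e r).2 then c (e r).1 - c (e r).2 else 0))
        - (if k = 0 then (1 - t) * w 0 * c k else 0) = -ρ * c k) ∧
      spectralGap (tensorFun (fun _ : Fin (K + 1) => ν)) P = ρ := by
  have hh0 : 0 < (1 - t) * w 0 := mul_pos (by linarith) hw00
  obtain ⟨c, ρ, hcpos, hcS, hρ0, _, hvertex⟩ := graph_groundState_exists e (t := t) (h := (1 - t) * w 0) hm ht0 hh0 hconn
  exact ⟨ρ, c, hρ0, groundState_rho_le_hot e hcpos ht0.le hvertex, hcpos, hcS, hvertex,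
    graphScheme_spectralGap_eq e hm he hν hν1 hM0 hidle hw0 hw00 hw1 ht0 ht1 hP hρ0 hcpos hvertex⟩

/-! ## §5 The relaxation floor for every `ε` -/

/-- **THE RELAXATION FLOOR (Levin–Peres–Wilmer Thm 12.5 at the exact eigenvalue `1 − ρ`): `(1/ρ − 1)·log(1/(2ε)) ≤ t_mix(ε)` for every `ε > 0`** and every positive solution `(c, ρ)`, `ρ > 0`
(`|S| ≥ 2`, same scheme). [ours] -/
theorem graphScheme_mixingTime_ge_relax [Nontrivial S] (hm : 1 ≤ m) (he : ∀ r, (e r).1 ≠ (e r).2) (hν : ∀ v, 0 < ν v) (hν1 : ∑ v, ν v = 1) (hM0 : ∀ u v, M 0 u v = ν v)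
    (hidle : ∀ i : Fin K, ∀ u v, M i.succ u v = if v = u then 1 else 0) (hw0 : ∀ k, 0 ≤ w k) (hw00 : 0 < w 0) (hw1 : ∑ k, w k = 1) (ht0 : 0 < t) (ht1 : t < 1)
    (hP : ∀ x y, P x y = t * ptGraphSwap (fun _ : Fin (K + 1) => ν) e (fun _ => Equiv.refl S) x y + (1 - t) * prodKernel w M x y)
    {c : Fin (K + 1) → ℝ} {ρ : ℝ} (hρ0 : 0 < ρ) (hc : ∀ k, 0 < c k)
    (hvertex : ∀ k : Fin (K + 1), t / m * ∑ r : Fin m, ((if k = (e r).1 then c (e r).2 - c (e r).1 else 0) + (if k = (e r).2 then c (e r).1 - c (e r).2 else 0))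
      - (if k = 0 then (1 - t) * w 0 * c k else 0) = -ρ * c k) {ε : ℝ} (hε : 0 < ε) :
    (1 / ρ - 1) * Real.log (1 / (2 * ε)) ≤ (mixingTime P (tensorFun (fun _ : Fin (K + 1) => ν)) ε : ℝ) := by
  have hμ : ∀ (k : Fin (K + 1)) (v : S), 0 < (fun _ : Fin (K + 1) => ν) k v := fun _ v => hν v
  have hπpos : ∀ x, 0 < tensorFun (fun _ : Fin (K + 1) => ν) x := tensorFun_pos hμ
  have hPst := graphScheme_isRowStochastic e hν hν1 hM0 hidle hw0 hw1 ht0.le ht1.le hP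
  have hDB := graphScheme_detailedBalance e hν hν1 hM0 hidle hP
  have hst := hDB.isStationary hPst.2
  have hM := (homLadder_kernels hν hν1 hM0 hidle).1
  have hh0 : 0 < (1 - t) * w 0 := mul_pos (by linarith) hw00
  have hw01 : w 0 ≤ 1 := by
    calc w 0 ≤ ∑ k, w k := Finset.single_le_sum (fun k _ => hw0 k) (mem_univ 0)
      _ = 1 := hw1
  -- sizes
  have hrho := groundState_rho_le_hot e hc ht0.le hvertex
  have hρ1 : ρ < 1 := by
    have hK1 : (1 : ℝ) ≤ (K : ℝ) + 1 := by have : (0 : ℝ) ≤ K := Nat.cast_nonneg K; linarith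
    have h1 : ρ ≤ ρ * ((K : ℝ) + 1) := le_mul_of_one_le_right hρ0.le hK1
    nlinarith
  have hmin := groundState_hot_is_min e hm ht0 hρ0 hc hvertex
  have hvertex' : ∀ k : Fin (K + 1), t / m * ∑ r : Fin m, ((if k = (e r).1 then c (e r).2 - c (e r).1 else 0) + (if k = (e r).2 then c (e r).1 - c (e r).2 else 0))
      - (if k = 0 then (1 - t) * w 0 * c 0 else 0) = -ρ * c k := by
    intro k
    have := hvertex k
    by_cases hk : k = 0
    · subst hk; exact this
    · rw [if_neg hk] at this ⊢; exact this
  -- a content with `ν(u) < 1` and the exact eigenfunction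
  obtain ⟨u⟩ : Nonempty S := inferInstance
  obtain ⟨v, hvu⟩ := exists_ne u
  have hνu : ν u < 1 := by
    have : ν u + ν v ≤ ∑ s, ν s := by
      rw [← sum_pair (Ne.symm hvu)]; exact sum_le_univ_sum_of_nonneg fun s => (hν s).le
    linarith [hν v]
  set a : S → ℝ := fun s => (if s = u then (1 : ℝ) else 0) - ν u with ha_def
  set Φ : (Fin (K + 1) → S) → ℝ := fun x => ∑ k : Fin (K + 1), c k * a (x k) with hΦ_def
  have hΦ : ∀ x, Φ x = ∑ k : Fin (K + 1), c k * a (x k) := fun x => rfl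
  have ha0 : ∑ s, ν s * a s = 0 := centredIndicator_mean hν1 u
  have heig : ∀ x, ∑ y, P x y * Φ y = (1 - ρ) * Φ x := graphScheme_oneLevel_eigen e hm he hν hν1 hM0 hidle hw1 hP ha0 hΦ hvertex'
  have hf : ∀ x, ∑ y, (P x y : ℂ) * ((Φ y : ℝ) : ℂ) = ((1 - ρ : ℝ) : ℂ) * ((Φ x : ℝ) : ℂ) := by
    intro x
    have := congrArg (fun r : ℝ => (r : ℂ)) (heig x)
    push_cast at this ⊢
    exact this
  have hΦ0 : Φ (fun _ : Fin (K + 1) => u) = (1 - ν u) * ∑ k : Fin (K + 1), c k := by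
    rw [hΦ, mul_sum]
    exact sum_congr rfl fun k _ => by rw [ha_def]; simp only [if_true]; ring
  have hS : 0 < ∑ k : Fin (K + 1), c k := by
    have : c 0 ≤ ∑ k : Fin (K + 1), c k := Finset.single_le_sum (fun k _ => (hc k).le) (mem_univ 0)
    linarith [hc 0]
  have hf0 : (fun x => ((Φ x : ℝ) : ℂ)) ≠ 0 := by
    intro hz
    have := congrFun hz (fun _ : Fin (K + 1) => u)
    simp only [Pi.zero_apply, Complex.ofReal_eq_zero] at this
    rw [hΦ0] at this
    exact (mul_pos (by linarith) hS).ne' this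
  have hlam : ((1 - ρ : ℝ) : ℂ) ≠ 1 := by
    intro h1
    have := congrArg Complex.re h1
    simp at this
    linarith
  have hnorm : ‖((1 - ρ : ℝ) : ℂ)‖ = 1 - ρ := by rw [Complex.norm_real, Real.norm_eq_abs, abs_of_pos (by linarith)]
  have hlam1 : ‖((1 - ρ : ℝ) : ℂ)‖ < 1 := by rw [hnorm]; linarith
  -- convergence from the ceiling
  have hPl : ∀ x y, P x y = t * ptGraphProposal e (fun _ => Equiv.refl S) x y + (1 - t) * w 0 * coordKernel M 0 x y + (1 - t - (1 - t) * w 0) * (if y = x then 1 else 0) :=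
    fun x y => by rw [hP, graphScheme_lazyForm e hm he hν hidle hw1]
  have hmix : ∃ t₀, worstTvDist P (tensorFun (fun _ : Fin (K + 1) => ν)) t₀ ≤ ε :=
    ⟨_, graphScheme_worstTvDist_le_of_ge_log e (h := (1 - t) * w 0) hm he ht0 hh0 (by nlinarith) hν hν1 hM hM0 hPl hρ0 hρ1.le (hc 0) hmin hvertex' hε (Nat.le_ceil _)⟩
  have h125 := LevinPeres2017_thm_12_5_tmix hst hf hf0 hlam hlam1 hε hmix
  rw [hnorm, show 1 - (1 - ρ) = ρ by ring] at h125
  exact h125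

end Summit.Ventures.LatticeQCDFlow.Scaling

end
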